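import Summits.HubbardSuperconductivity.HubbardSuperconductivity.Theorems.JosephsonMirrorJmInterchangeWindowPigeonhole

/-!
# Route `JosephsonMirror` — the a-priori bound on the Josephson coupling

Helper file for the crux stmt-HubbardSuperconductivity-2227 (`JmInterchange`) of route
`JosephsonMirror` (sub-problem `HubbardSuperconductivity`), line `Sketch`, stub
`stub_couplingExpectBound`: the abstract finite-dimensional bound `couplingExpectBound`.

For the Josephson coupling `K = D ⊗ D̄ + Dᴴ ⊗ D̄ᴴ` (`D̄ = Dᴴᵀ`) on two-layer vectors
`ψ : ι × ι → ℂ` and the one-layer bounds `‖D v‖², ‖Dᴴ v‖² ≤ M ‖v‖²`: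

  `Re ⟨ψ, K ψ⟩ ≤ 2 M ‖ψ‖²`.

In Lieb's packaging `ψ = ψ_W`, `W s t = ψ (s,t)`, one has
`⟨ψ_W, K ψ_W⟩ = ⟨Dᴴ W, W Dᴴ⟩_HS + ⟨D W, W D⟩_HS` (`star_vec_coupling_mulVec_vec`, `hsInner_conj_eq`);
the Hilbert–Schmidt AM–GM inequality `2 Re ⟨X, Y⟩_HS ≤ ‖X‖²_HS + ‖Y‖²_HS`
(`two_mul_re_hsInner_le` at `λ = 1`) and the column / row estimates
`‖X W‖²_HS = Σ_t ‖X w_t‖² ≤ M ‖W‖²_HS`, `‖W X‖²_HS = ‖Xᴴ Wᴴ‖²_HS ≤ M ‖Wᴴ‖²_HS = M ‖W‖²_HS`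
finish the proof.

Sources: E. H. Lieb, Phys. Rev. Lett. 62 (1989) 1201 (the `W`-matrix packaging); T. Koma,
H. Tasaki, J. Stat. Phys. 76 (1994) 745. All statements are folklore linear algebra.
No new definitions.
-/

-- the mandated namespace `Summit.<Summit>.<Problem>.Theorems` repeats `HubbardSuperconductivity`
-- (single-problem summit, D-0017), which the `dupNamespace` linter flags on every declaration
set_option linter.dupNamespace false

namespace Summit.HubbardSuperconductivity.HubbardSuperconductivity.Theorems.JosephsonMirror

open Matrix Literature.MathematicalPhysics.QuantumLattice
open scoped Kronecker ComplexOrder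

variable {ι : Type*} [Fintype ι]

/-- `‖W X‖²_HS = ‖Xᴴ Wᴴ‖²_HS` (`(W X)ᴴ = Xᴴ Wᴴ` and cyclicity of the trace). [folklore] -/
theorem hsInner_mul_self_eq_conjTranspose (W X : Matrix ι ι ℂ) :
    hsInner (W * X) (W * X) = hsInner (Xᴴ * Wᴴ) (Xᴴ * Wᴴ) := by
  simp only [hsInner, conjTranspose_mul, conjTranspose_conjTranspose]
  rw [trace_mul_comm]

/-- `‖Wᴴ‖²_HS = ‖W‖²_HS` (cyclicity of the trace). [folklore] -/
theorem hsInner_conjTranspose_self (W : Matrix ι ι ℂ) :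
    hsInner Wᴴ Wᴴ = hsInner W W := by
  simp only [hsInner, conjTranspose_conjTranspose]
  rw [trace_mul_comm]

/-- The column estimate: if `‖X v‖² ≤ M ‖v‖²` for all `v`, then `‖X W‖²_HS ≤ M ‖W‖²_HS`
(`‖X W‖²_HS = Σ_t ‖X w_t‖²` and `‖W‖²_HS = Σ_t ‖w_t‖²` over the columns `w_t = W · e_t`).
[folklore] -/
theorem re_hsInner_mul_self_le (X W : Matrix ι ι ℂ) {M : ℝ}
    (hX : ∀ v : ι → ℂ, (star (X *ᵥ v) ⬝ᵥ (X *ᵥ v)).re ≤ M * (star v ⬝ᵥ v).re) :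
    (hsInner (X * W) (X * W)).re ≤ M * (hsInner W W).re := by
  rw [hsInner_mul_self_eq_sum_cols, Complex.re_sum, ← star_vec_dotProduct_vec W W,
    star_vec_self_eq_sum_cols, Complex.re_sum, Finset.mul_sum]
  exact Finset.sum_le_sum fun t _ => hX _

/-- The a-priori coupling bound on a packaged matrix:
`Re ⟨ψ_W, (D ⊗ D̄ + Dᴴ ⊗ D̄ᴴ) ψ_W⟩ ≤ 2 M ‖W‖²_HS` from `‖D v‖², ‖Dᴴ v‖² ≤ M ‖v‖²`
(`⟨ψ_W, K ψ_W⟩ = ⟨Dᴴ W, W Dᴴ⟩_HS + ⟨D W, W D⟩_HS`, Hilbert–Schmidt AM–GM, and the column / row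
estimates). Lieb, PRL 62 (1989) 1201, eq. (4). [folklore] -/
theorem re_star_vec_coupling_mulVec_vec_le (D W : Matrix ι ι ℂ) {M : ℝ}
    (hD : ∀ v : ι → ℂ, (star (D *ᵥ v) ⬝ᵥ (D *ᵥ v)).re ≤ M * (star v ⬝ᵥ v).re)
    (hDh : ∀ v : ι → ℂ, (star (Dᴴ *ᵥ v) ⬝ᵥ (Dᴴ *ᵥ v)).re ≤ M * (star v ⬝ᵥ v).re) :
    (star (fun p : ι × ι => W p.1 p.2) ⬝ᵥ (D ⊗ₖ Dᴴᵀ + Dᴴ ⊗ₖ Dᵀ) *ᵥ (fun p : ι × ι => W p.1 p.2)).re ≤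
      2 * M * (hsInner W W).re := by
  rw [star_vec_coupling_mulVec_vec, Complex.add_re]
  have hN : (hsInner Wᴴ Wᴴ).re = (hsInner W W).re := by rw [hsInner_conjTranspose_self]
  have h1 : (hsInner (Dᴴ * W) (Dᴴ * W)).re ≤ M * (hsInner W W).re := re_hsInner_mul_self_le _ _ hDh
  have h2 : (hsInner (D * W) (D * W)).re ≤ M * (hsInner W W).re := re_hsInner_mul_self_le _ _ hD
  have h3 : (hsInner (W * Dᴴ) (W * Dᴴ)).re ≤ M * (hsInner W W).re := by
    rw [hsInner_mul_self_eq_conjTranspose, conjTranspose_conjTranspose, ← hN]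
    exact re_hsInner_mul_self_le _ _ hD
  have h4 : (hsInner (W * D) (W * D)).re ≤ M * (hsInner W W).re := by
    rw [hsInner_mul_self_eq_conjTranspose, ← hN]
    exact re_hsInner_mul_self_le _ _ hDh
  have hT1 : 2 * (hsInner W (D * W * Dᴴ)).re ≤ 2 * (M * (hsInner W W).re) := by
    rw [hsInner_conj_eq]
    have h := two_mul_re_hsInner_le (Dᴴ * W) (W * Dᴴ) one_pos
    rw [inv_one, one_mul, one_mul] at h
    linarith
  have hT2 : 2 * (hsInner W (Dᴴ * W * D)).re ≤ 2 * (M * (hsInner W W).re) := by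
    have h := two_mul_re_hsInner_le (Dᴴᴴ * W) (W * Dᴴᴴ) one_pos
    rw [← hsInner_conj_eq, inv_one, one_mul, one_mul, conjTranspose_conjTranspose] at h
    linarith
  linarith

/-- **The a-priori bound on the Josephson coupling.** For `K = D ⊗ D̄ + Dᴴ ⊗ D̄ᴴ` (`D̄ = Dᴴᵀ`) on
two-layer vectors `ψ : ι × ι → ℂ` and the one-layer bounds `‖D v‖², ‖Dᴴ v‖² ≤ M ‖v‖²`:
`Re ⟨ψ, K ψ⟩ ≤ 2 M ‖ψ‖²` (package `ψ = ψ_W` with `W s t = ψ (s,t)` and apply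
`re_star_vec_coupling_mulVec_vec_le`). Lieb, PRL 62 (1989) 1201, eq. (4); Koma–Tasaki,
J. Stat. Phys. 76 (1994) 745. [folklore] -/
theorem couplingExpectBound [DecidableEq ι] (D : Matrix ι ι ℂ) (M : ℝ) (ψ : ι × ι → ℂ) (_hM : 0 ≤ M)
    (hD : ∀ v : ι → ℂ, (star (D *ᵥ v) ⬝ᵥ (D *ᵥ v)).re ≤ M * (star v ⬝ᵥ v).re)
    (hDh : ∀ v : ι → ℂ, (star (Dᴴ *ᵥ v) ⬝ᵥ (Dᴴ *ᵥ v)).re ≤ M * (star v ⬝ᵥ v).re) :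
    (star ψ ⬝ᵥ (D ⊗ₖ Dᴴᵀ + Dᴴ ⊗ₖ Dᵀ) *ᵥ ψ).re ≤ 2 * M * (star ψ ⬝ᵥ ψ).re := by
  have h := re_star_vec_coupling_mulVec_vec_le D (Matrix.of fun s t => ψ (s, t)) hD hDh
  rw [← star_vec_dotProduct_vec, vec_of_eq ψ] at h
  exact h

end Summit.HubbardSuperconductivity.HubbardSuperconductivity.Theorems.JosephsonMirror
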